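import Mathlib
import HarnessLib
import Summits.ValiantsHypothesis.ValiantsHypothesis.Theorems.IntercalateMatrix
import Summits.ValiantsHypothesis.ValiantsHypothesis.Theorems.SOSBilinearCalibration

/-!
# Integer sums-of-squares formulas: `k⁶ ≤ 250 · S_ℤ(SOS_k)⁵` (HWY Theorem 1.10)

Workshop file for the node `CommutativityDial` (decomposition workshop `decomp-valiant`, lens 6
«restricted-models lifting axis», gen 34; census cell D2 / W15; CALL O-L6-10 (bus 1303), FILE 2 of 2;
sequel of `IntercalateMatrix`). The road in print to the attackable conjunct `A_nc = PerNotNcVP` is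
HWY's Theorem 1.7 (`HWY10_thm_1_7_holds` in `NcSOSPermanent`); its hypothesis is the numeric conjecture
`HWY10.SOSBilinearSuperlinear ℂ`. Along the COEFFICIENT DIAL `R ↦ "S_R(SOS_k) ≥ c·k^{1+ε}"` the one
position that is a theorem in print is `R = ℤ`: HWY's Theorem 1.10, `S_ℤ(k) ≥ Ω(k^{6/5})` (journal
version Canad. Math. Bull. 56 (2013) 70–79, Thm 1.1), where `S_ℤ(SOS_k) = sqComplexity ℤ (sosPoly ℤ k)`
(`SOSBilinearCalibration`) is the least `m` with `SOS_k = z_1² + ⋯ + z_m²`, `z_l` INTEGER bilinear forms.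

Content. §0: two algebraic expansions, the integer unit-vector lemma (`Σ v_l² = 1` over `ℤ` forces one
`±1` and zeros) and the sign rule of a `2 × 2` minor. §1: evaluating an integer formula
`SOS_k = Σ_l z_l²` at the vectors `e_i`, `e_i + e_i'`, `e_j`, `e_j + e_j'` gives the coefficient
identities `Σ_l z_{lij}² = 1`, `Σ_l z_{lij} z_{lij'} = 0` (`j ≠ j'`), `Σ_l z_{lij} z_{li'j} = 0`
(`i ≠ i'`), `Σ_l (z_{lij} z_{li'j'} + z_{lij'} z_{li'j}) = 0` — HWY–CMB Prop 2.2 (⇒), after Yiu — whence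
a `k × k` signed intercalate matrix with colours from `Fin m` (`nonempty_intercalate`: colour of `(i,j)`
= the unique `l` with `z_{lij} = ±1`, sign exponent = `[z_{lij} = -1]`). §2: with `Intercalate.bound`
(FILE 1, HWY Thm E.5) the headline `pow_six_le : k ^ 6 ≤ 250 * sqComplexity ℤ (sosPoly ℤ k) ^ 5`, and
its restatement in the currency of `HWY10.SOSBilinearSuperlinear` with `ε = 1/5`
(`sqComplexity_int_superlinear`, for `S_ℤ` in place of `B_ℂ`).

HONEST FRAMING: a theorem in PRINT (HWY STOC 2010 Thm 1.10 = CMB 2013 Thm 1.1; the matrix step is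
Yiu 1987 / Yuzvinsky 1981), KERNEL-NEW. It is the restricted-COEFFICIENT rung `R = ℤ` of the road
hypothesis of D2/W15, NOT the hypothesis (`R = ℂ`, where the mechanism used here — anisotropy of `x²`
and discreteness of `ℤ` — is absent: over `ℂ`, `S_ℂ(SOS_k) ≤ O(k²/log k)` and nothing superlinear is
known); no circuit lower bound follows (HWY p. 6: "does not imply a circuit lower bound"); it does not
bear on `S_ℂ`, on `A_nc`, or on `VP ≠ VNP`.

## References
* [HrubesWigdersonYehudayoff2010] P. Hrubeš, A. Wigderson, A. Yehudayoff, Non-commutative circuits and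
  the sum-of-squares problem, STOC 2010, 667–676: §1.3 (`S_F`), Thm 1.10, App. E (Prop E.1, Thm E.5).
  [HrubesWigdersonYehudayoff2013] — , An asymptotic bound on the composition number of integer sums of
  squares formulas, Canad. Math. Bull. 56 (2013) 70–79, doi:10.4153/CMB-2011-143-x (Thm 1.1, Prop 2.2).
* [Yiu1987] P. Yiu, Sums of squares formulae with integer coefficients, Canad. Math. Bull. 30 (1987)
  318–324. [Yuzvinsky1981] S. Yuzvinsky, Orthogonal pairings of Euclidean spaces, Michigan Math. J. 28
  (1981) 131–145.
-/

noncomputable section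

namespace Summit.ValiantsHypothesis.ValiantsHypothesis.Theorems.IntegerSumsOfSquares

open MvPolynomial Matrix
open Literature.Computability.AlgebraicComplexity
open Summit.ValiantsHypothesis.ValiantsHypothesis.Theorems.SOSBilinearCalibration
open Summit.ValiantsHypothesis.ValiantsHypothesis.Theorems.IntercalateMatrix

/-! ## §0 Expansions, the integer unit-vector lemma, the sign rule -/

/-- `Σ (f+g)² = Σ f² + Σ g² + 2 Σ fg` (algebra for Prop 2.2). No circuit lower bound follows (HWY p6); does not bear on `S_ℂ`.
[cite: HrubesWigdersonYehudayoff2010, Thm 1.10 / App. E Prop E.1; HrubesWigdersonYehudayoff2013, Prop 2.2 (proof); Yiu1987; Yuzvinsky1981] -/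
theorem sum_expand2 {m : ℕ} (f g : Fin m → ℤ) :
    ∑ l, (f l + g l) ^ 2 = ∑ l, f l ^ 2 + ∑ l, g l ^ 2 + 2 * ∑ l, f l * g l := by
  simp only [Finset.mul_sum, ← Finset.sum_add_distrib]
  exact Finset.sum_congr rfl fun l _ => by ring

/-- `Σ (f+g+p+q)²` expanded into its ten sums, the two cross sums `Σ fq`, `Σ gp` kept together
(algebra for Prop 2.2). No circuit lower bound follows (HWY p6); does not bear on `S_ℂ`.
[cite: HrubesWigdersonYehudayoff2010, Thm 1.10 / App. E Prop E.1; HrubesWigdersonYehudayoff2013, Prop 2.2 (proof); Yiu1987; Yuzvinsky1981] -/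
theorem sum_expand4 {m : ℕ} (f g p q : Fin m → ℤ) :
    ∑ l, (f l + g l + (p l + q l)) ^ 2 =
      ∑ l, f l ^ 2 + ∑ l, g l ^ 2 + ∑ l, p l ^ 2 + ∑ l, q l ^ 2 +
        2 * ∑ l, f l * g l + 2 * ∑ l, p l * q l + 2 * ∑ l, f l * p l + 2 * ∑ l, g l * q l +
        2 * ∑ l, (f l * q l + g l * p l) := by
  simp only [Finset.mul_sum, ← Finset.sum_add_distrib]
  exact Finset.sum_congr rfl fun l _ => by ring

/-- DISCRETENESS of `ℤ`: if `Σ_l v_l² = 1` and `v_a ≠ 0`, then `v_a² = 1` and `v_b = 0` for `b ≠ a`.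
No circuit lower bound follows (HWY p6); does not bear on `S_ℂ`.
[cite: HrubesWigdersonYehudayoff2010, Thm 1.10 / App. E Prop E.1; HrubesWigdersonYehudayoff2013, Prop 2.2 (proof); Yiu1987; Yuzvinsky1981] -/
theorem int_sq_sum_eq_one {m : ℕ} {v : Fin m → ℤ} (hv : ∑ l, v l ^ 2 = 1) {a : Fin m}
    (ha : v a ≠ 0) : v a ^ 2 = 1 ∧ ∀ b, b ≠ a → v b = 0 := by
  have hpos : 0 < v a ^ 2 := lt_of_le_of_ne (sq_nonneg (v a)) (Ne.symm (pow_ne_zero 2 ha))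
  have ha1 : 1 ≤ v a ^ 2 := by omega
  have hle : v a ^ 2 ≤ ∑ l, v l ^ 2 :=
    Finset.single_le_sum (fun l _ => sq_nonneg (v l)) (Finset.mem_univ a)
  refine ⟨le_antisymm (hle.trans_eq hv) ha1, fun b hb => ?_⟩
  have h2 : ∑ l ∈ ({a, b} : Finset (Fin m)), v l ^ 2 ≤ ∑ l, v l ^ 2 :=
    Finset.sum_le_sum_of_subset_of_nonneg (Finset.subset_univ _) fun l _ _ => sq_nonneg (v l)
  rw [Finset.sum_pair (Ne.symm hb)] at h2
  have h0 : v b ^ 2 ≤ 0 := by linarith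
  exact (pow_eq_zero_iff two_ne_zero).1 (le_antisymm h0 (sq_nonneg _))

/-- SIGN RULE of a `2 × 2` minor: for `a, b, c, d ∈ {±1}` with `ad + bc = 0`, the sign exponents
(`0` for `+1`, `1` for `-1`) add up to `1` in `ZMod 2`. No circuit lower bound follows (HWY p6); does not bear on `S_ℂ`.
[cite: HrubesWigdersonYehudayoff2010, Thm 1.10 / App. E.1 (3); HrubesWigdersonYehudayoff2013, §2 (3); Yiu1987; Yuzvinsky1981] -/
theorem sign_rule {a b c d : ℤ} (ha : a = 1 ∨ a = -1) (hb : b = 1 ∨ b = -1) (hc : c = 1 ∨ c = -1)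
    (hd : d = 1 ∨ d = -1) (h : a * d + b * c = 0) :
    (if a = 1 then (0 : ZMod 2) else 1) + (if b = 1 then (0 : ZMod 2) else 1) +
        (if c = 1 then (0 : ZMod 2) else 1) + (if d = 1 then (0 : ZMod 2) else 1) = 1 := by
  rcases ha with rfl | rfl <;> rcases hb with rfl | rfl <;> rcases hc with rfl | rfl <;>
    rcases hd with rfl | rfl <;> first | decide | exact absurd h (by decide)

/-! ## §1 Evaluating an integer formula `SOS_k = Σ_l z_l²` at signed unit vectors -/

variable {k m : ℕ} (z : Fin m → Fin k → Fin k → ℤ)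
  (h : HWY10.sosPoly ℤ k = ∑ l, HWY10.bilinForm ℤ (z l) ^ 2)
include h

/-- Evaluating the formula: `(x·x)(y·y) = Σ_l (xᵀ Z_l y)²` for all integer vectors `x, y`.
No circuit lower bound follows (HWY p6); does not bear on `S_ℂ`.
[cite: HrubesWigdersonYehudayoff2010, §1.3 / Thm 1.10; HrubesWigdersonYehudayoff2013, Prop 2.2; Yiu1987; Yuzvinsky1981] -/
theorem eval_identity (x y : Fin k → ℤ) :
    (x ⬝ᵥ x) * (y ⬝ᵥ y) = ∑ l, (x ⬝ᵥ fun i => z l i ⬝ᵥ y) ^ 2 := by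
  have hx := congrArg (MvPolynomial.eval (Sum.elim x y)) h
  simp only [eval_sosPoly, map_sum, map_pow, eval_bilinForm] at hx
  exact hx

/-- `x = e_i`, `y = e_j`: `Σ_l z_{lij}² = 1`. No circuit lower bound follows (HWY p6); does not bear on `S_ℂ`.
[cite: HrubesWigdersonYehudayoff2010, Thm 1.10 / App. E Prop E.1; HrubesWigdersonYehudayoff2013, Prop 2.2; Yiu1987; Yuzvinsky1981] -/
theorem sum_sq_coeff (i j : Fin k) : ∑ l, z l i j ^ 2 = 1 := by
  have e := eval_identity z h (Pi.single i 1) (Pi.single j 1)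
  simp only [single_dotProduct, dotProduct_single, Pi.single_eq_same, mul_one, one_mul] at e
  have e2 := e.trans (Finset.sum_congr rfl fun l _ => (by ring : _ = z l i j ^ 2))
  linarith

/-- `x = e_i`, `y = e_j + e_j'` (`j ≠ j'`): `Σ_l z_{lij} z_{lij'} = 0`. No circuit lower bound follows (HWY p6); does not bear on `S_ℂ`.
[cite: HrubesWigdersonYehudayoff2010, Thm 1.10 / App. E Prop E.1; HrubesWigdersonYehudayoff2013, Prop 2.2; Yiu1987; Yuzvinsky1981] -/
theorem sum_row (i : Fin k) {j j' : Fin k} (hj : j ≠ j') : ∑ l, z l i j * z l i j' = 0 := by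
  have e := eval_identity z h (Pi.single i 1) (Pi.single j 1 + Pi.single j' 1)
  simp only [dotProduct_add, single_dotProduct, dotProduct_single, Pi.add_apply, Pi.single_eq_same,
    Pi.single_eq_of_ne hj, Pi.single_eq_of_ne hj.symm, mul_one, one_mul, add_zero, zero_add] at e
  have e2 := e.trans (Finset.sum_congr rfl fun l _ => (by ring : _ = (z l i j + z l i j') ^ 2))
  rw [sum_expand2] at e2
  linarith [sum_sq_coeff z h i j, sum_sq_coeff z h i j']

/-- `x = e_i + e_i'` (`i ≠ i'`), `y = e_j`: `Σ_l z_{lij} z_{li'j} = 0`. No circuit lower bound follows (HWY p6); does not bear on `S_ℂ`.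
[cite: HrubesWigdersonYehudayoff2010, Thm 1.10 / App. E Prop E.1; HrubesWigdersonYehudayoff2013, Prop 2.2; Yiu1987; Yuzvinsky1981] -/
theorem sum_col (j : Fin k) {i i' : Fin k} (hi : i ≠ i') : ∑ l, z l i j * z l i' j = 0 := by
  have e := eval_identity z h (Pi.single i 1 + Pi.single i' 1) (Pi.single j 1)
  simp only [add_dotProduct, dotProduct_add, single_dotProduct, dotProduct_single, Pi.add_apply,
    Pi.single_eq_same, Pi.single_eq_of_ne hi, Pi.single_eq_of_ne hi.symm, mul_one, one_mul,
    add_zero, zero_add] at e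
  have e2 := e.trans (Finset.sum_congr rfl fun l _ => (by ring : _ = (z l i j + z l i' j) ^ 2))
  rw [sum_expand2] at e2
  linarith [sum_sq_coeff z h i j, sum_sq_coeff z h i' j]

/-- `x = e_i + e_i'`, `y = e_j + e_j'` (`i ≠ i'`, `j ≠ j'`):
`Σ_l (z_{lij} z_{li'j'} + z_{lij'} z_{li'j}) = 0`. No circuit lower bound follows (HWY p6); does not bear on `S_ℂ`.
[cite: HrubesWigdersonYehudayoff2010, Thm 1.10 / App. E Prop E.1; HrubesWigdersonYehudayoff2013, Prop 2.2; Yiu1987; Yuzvinsky1981] -/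
theorem sum_cross {i i' j j' : Fin k} (hi : i ≠ i') (hj : j ≠ j') :
    ∑ l, (z l i j * z l i' j' + z l i j' * z l i' j) = 0 := by
  have e := eval_identity z h (Pi.single i 1 + Pi.single i' 1) (Pi.single j 1 + Pi.single j' 1)
  simp only [add_dotProduct, dotProduct_add, single_dotProduct, dotProduct_single, Pi.add_apply,
    Pi.single_eq_same, Pi.single_eq_of_ne hi, Pi.single_eq_of_ne hi.symm, Pi.single_eq_of_ne hj,
    Pi.single_eq_of_ne hj.symm, mul_one, one_mul, add_zero, zero_add] at e
  have e2 := e.trans (Finset.sum_congr rfl fun l _ =>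
    (by ring : _ = (z l i j + z l i j' + (z l i' j + z l i' j')) ^ 2))
  rw [sum_expand4] at e2
  linarith [sum_sq_coeff z h i j, sum_sq_coeff z h i j', sum_sq_coeff z h i' j,
    sum_sq_coeff z h i' j', sum_row z h i hj, sum_row z h i' hj, sum_col z h j hi,
    sum_col z h j' hi]

/-- Every cell `(i, j)` has a nonzero coefficient in some `z_l`. No circuit lower bound follows (HWY p6); does not bear on `S_ℂ`.
[cite: HrubesWigdersonYehudayoff2010, Thm 1.10 / App. E Prop E.1; HrubesWigdersonYehudayoff2013, Prop 2.2; Yiu1987; Yuzvinsky1981] -/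
theorem exists_ne_zero (i j : Fin k) : ∃ l, z l i j ≠ 0 := by
  by_contra hcon
  have h0 : ∑ l, z l i j ^ 2 = 0 := Finset.sum_eq_zero fun l _ => by
    have hl : z l i j = 0 := by
      by_contra hl
      exact hcon ⟨l, hl⟩
    rw [hl]
    norm_num
  have h1 := sum_sq_coeff z h i j
  omega

/-- **HWY–CMB Proposition 2.2 (⇒) / HWY Prop E.1, after Yiu**: an integer formula
`SOS_k = z_1² + ⋯ + z_m²` yields a `k × k` signed intercalate matrix with colours from `Fin m`
(colour of `(i,j)` = the unique `l` with `z_{lij} = ±1`; sign exponent `1` iff `z_{lij} = -1`).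
No circuit lower bound follows (HWY p. 6); does not bear on `S_ℂ`.
[cite: HrubesWigdersonYehudayoff2010, Thm 1.10 / App. E Prop E.1; HrubesWigdersonYehudayoff2013, Prop 2.2; Yiu1987; Yuzvinsky1981] -/
theorem nonempty_intercalate : Nonempty (Intercalate k m) := by
  choose c hc using fun i j => exists_ne_zero z h i j
  have zero_of_ne : ∀ i j l, l ≠ c i j → z l i j = 0 := fun i j l hl =>
    (int_sq_sum_eq_one (sum_sq_coeff z h i j) (hc i j)).2 l hl
  have eq_c : ∀ i j l, z l i j ≠ 0 → l = c i j := fun i j l hl => by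
    by_contra hne
    exact hl (zero_of_ne i j l hne)
  have unit : ∀ i j, z (c i j) i j = 1 ∨ z (c i j) i j = -1 := fun i j =>
    mul_self_eq_one_iff.1 ((sq _).symm.trans (int_sq_sum_eq_one (sum_sq_coeff z h i j) (hc i j)).1)
  have single : ∀ i j (g : Fin m → ℤ), ∑ l, z l i j * g l = z (c i j) i j * g (c i j) :=
    fun i j g => Finset.sum_eq_single_of_mem (c i j) (Finset.mem_univ _) fun l _ hl => by
      rw [zero_of_ne i j l hl, zero_mul]
  refine ⟨{ c := c
            σ := fun i j => if z (c i j) i j = 1 then 0 else 1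
            row_inj := ?_
            col_inj := ?_
            inter := ?_ }⟩
  · intro i j j' e
    by_contra hne
    have hs : z (c i j) i j * z (c i j) i j' = 0 :=
      calc z (c i j) i j * z (c i j) i j' = ∑ l, z l i j * z l i j' :=
            (single i j fun l => z l i j').symm
        _ = 0 := sum_row z h i hne
    exact mul_ne_zero (hc i j) (by rw [e]; exact hc i j') hs
  · intro j i i' e
    have e' : c i j = c i' j := e
    by_contra hne
    have hs : z (c i j) i j * z (c i j) i' j = 0 :=
      calc z (c i j) i j * z (c i j) i' j = ∑ l, z l i j * z l i' j :=
            (single i j fun l => z l i' j).symm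
        _ = 0 := sum_col z h j hne
    exact mul_ne_zero (hc i j) (by rw [e']; exact hc i' j) hs
  · intro i₁ i₂ j₁ j₂ hi hj hcol
    have hPQ := sum_cross z h hi hj
    rw [Finset.sum_add_distrib, single i₁ j₁, single i₁ j₂] at hPQ
    have h22 : z (c i₁ j₁) i₂ j₂ ≠ 0 := by rw [hcol]; exact hc i₂ j₂
    have hQ : z (c i₁ j₂) i₂ j₁ ≠ 0 := by
      intro h0
      rw [h0, mul_zero, add_zero] at hPQ
      exact mul_ne_zero (hc i₁ j₁) h22 hPQ
    have hcol' : c i₁ j₂ = c i₂ j₁ := eq_c i₂ j₁ _ hQ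
    refine ⟨hcol', ?_⟩
    have ed : z (c i₁ j₁) i₂ j₂ = z (c i₂ j₂) i₂ j₂ := by rw [hcol]
    have ec : z (c i₁ j₂) i₂ j₁ = z (c i₂ j₁) i₂ j₁ := by rw [hcol']
    rw [ed, ec] at hPQ
    exact sign_rule (unit i₁ j₁) (unit i₁ j₂) (unit i₂ j₁) (unit i₂ j₂) hPQ

omit h

/-! ## §2 The headline: HWY Theorem 1.10 / CMB Theorem 1.1 in numeric form -/

/-- **Hrubeš–Wigderson–Yehudayoff, Theorem 1.10 (STOC 2010) = Theorem 1.1 (CMB 2013), in the kernel,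
numeric form**: `k⁶ ≤ 250 · S_ℤ(SOS_k)⁵`, i.e. `S_ℤ(k) ≥ (k^{6/5})/250^{1/5}` — an integer
sum-of-squares formula with `S_ℤ(SOS_k)` squares (the infimum is attained, `exists_sqRep_of_sqRep`;
a formula exists, `sosPoly_eq_sum_sq`) gives an intercalate matrix (`nonempty_intercalate`), and
`Intercalate.bound` (HWY Thm E.5) bounds it. HONEST GRADE: theorem in PRINT, kernel-new; the
restricted-coefficient rung `R = ℤ` of the D2/W15 road hypothesis, not the hypothesis (`ℂ`);
no circuit lower bound follows (HWY p6); does not bear on `S_ℂ`; `VP ≠ VNP` untouched.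
[cite: HrubesWigdersonYehudayoff2010, Thm 1.10 / App. E Thm E.5; HrubesWigdersonYehudayoff2013, Thm 1.1; Yiu1987; Yuzvinsky1981] -/
theorem pow_six_le (k : ℕ) : k ^ 6 ≤ 250 * sqComplexity ℤ (HWY10.sosPoly ℤ k) ^ 5 := by
  obtain ⟨z₀, hz₀⟩ := sosPoly_eq_sum_sq ℤ k
  obtain ⟨w, hw⟩ := exists_sqRep_of_sqRep z₀ hz₀
  obtain ⟨M⟩ := nonempty_intercalate w hw
  exact M.bound

/-- The INTEGER point of the coefficient dial in the verbatim currency of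
`HWY10.SOSBilinearSuperlinear` (with `S_ℤ` for `B_F`): `S_ℤ(SOS_k) ≥ c · k^{1+ε}` for `ε = 1/5`,
`c = 250^{-1/5}`. No circuit lower bound follows (HWY p6); does not bear on `S_ℂ`.
[cite: HrubesWigdersonYehudayoff2010, Thm 1.10 / App. E Thm E.5; HrubesWigdersonYehudayoff2013, Thm 1.1; Yiu1987; Yuzvinsky1981] -/
theorem sqComplexity_int_superlinear : ∃ ε : ℝ, 0 < ε ∧ ∃ c : ℝ, 0 < c ∧
    ∀ k : ℕ, c * (k : ℝ) ^ (1 + ε) ≤ (sqComplexity ℤ (HWY10.sosPoly ℤ k) : ℝ) := by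
  refine ⟨((5 : ℕ) : ℝ)⁻¹, by positivity, (1 / 250 : ℝ) ^ ((5 : ℕ) : ℝ)⁻¹, by positivity,
    fun k => ?_⟩
  have hk : (0 : ℝ) ≤ k := Nat.cast_nonneg k
  have hS : (0 : ℝ) ≤ (sqComplexity ℤ (HWY10.sosPoly ℤ k) : ℝ) := Nat.cast_nonneg _
  have hR : (k : ℝ) ^ 6 ≤ 250 * (sqComplexity ℤ (HWY10.sosPoly ℤ k) : ℝ) ^ 5 := by
    exact_mod_cast pow_six_le k
  have he : (1 : ℝ) + ((5 : ℕ) : ℝ)⁻¹ = ((6 : ℕ) : ℝ) * ((5 : ℕ) : ℝ)⁻¹ := by norm_num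
  rw [he, Real.rpow_mul hk, Real.rpow_natCast,
    ← Real.mul_rpow (x := (1 / 250 : ℝ)) (y := (k : ℝ) ^ 6) (by norm_num) (by positivity)]
  calc ((1 / 250 : ℝ) * (k : ℝ) ^ 6) ^ ((5 : ℕ) : ℝ)⁻¹
      ≤ ((sqComplexity ℤ (HWY10.sosPoly ℤ k) : ℝ) ^ 5) ^ ((5 : ℕ) : ℝ)⁻¹ :=
        Real.rpow_le_rpow (by positivity) (by linarith) (by positivity)
    _ = (sqComplexity ℤ (HWY10.sosPoly ℤ k) : ℝ) := Real.pow_rpow_inv_natCast hS (by norm_num)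

end Summit.ValiantsHypothesis.ValiantsHypothesis.Theorems.IntegerSumsOfSquares

end
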